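import Literature.NumberTheory.GaloisCohomology.KolyvaginSystems
import Literature.NumberTheory.GaloisRepresentations.ContinuousCorestriction
import Literature.NumberTheory.GaloisRepresentations.GaloisCohomologyScalarAction
import Literature.NumberTheory.EllipticCurves.HeegnerModuleIndex
import Literature.NumberTheory.EllipticCurves.SelmerGaloisAction
import Literature.NumberTheory.GaloisRepresentations.LocalTatePairing
import Mathlib.LinearAlgebra.PiTensorProduct.Basic
import Mathlib.RingTheory.AdicCompletion.Basic
import Mathlib.RingTheory.LocalRing.ResidueField.Defs
import HarnessLib

/-!
# Howard 2004, §1.1–1.3: Selmer structures, Kolyvagin primes, Selmer triples (DEFINITIONS ONLY)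

Source: B. Howard, *The Heegner point Kolyvagin system*, Compositio Math. **140** (2004) 1439–1472,
§1.1–§1.3 (= arXiv:1202.6340 §2.1–§2.3; the arXiv section numbers are the journal's plus one:
arXiv Def. 2.1.10 = journal Def. 1.1.10, etc.).  Cell `pub/bsd-print-x9`, unit (W9)-A (plan g11
ruling 2026-08-28): the ABSTRACT VOCABULARY over a coefficient ring in which Howard's Thm. 1.6.1
(the discrete-valuation-ring Kolyvagin bound; arXiv Thm. 2.6.1) can later be typed print-exact
(part B, a separate cite-only file) and instantiated at the Eisenstein specialisations
`Λ/(T^m + p)` of the anticyclotomic deformation of `T_p E` (the D1 lineage's carrier).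

DEFINITIONS WITH BODIES ONLY (D-0026 / D-0014): nothing is asserted, no named fact, no `sorry`.
HONEST FRAMING: every definition below is Howard's text read at the FINITE (Artinian) level — his
induction §1.3–1.6 runs over principal Artinian coefficient rings of finite length, i.e. finite
rings, for which `T` is a finite discrete `Γ_K`-module and the tree's `ℤ`-linear layer
(`DiscreteGaloisModule`, `galoisCohomology`, `SelmerStructure`, `selmerGroup`, `unramifiedSubgroup`,
`transverseSubgroup`, `SelmerStructure.modify`) carries it verbatim («Let `R` be a principal
Artinian coefficient ring of length `k` and `T` an object of `Mod_{R,G_K}` … assume that `(T, F)`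
and `(T*, F*)` satisfy hypotheses H.0–H.5», arXiv p. 8 L5–12); the `R`-module structure on `H¹` is
the single shared layer of `GaloisRepresentations.GaloisCohomologyScalarAction` (x10b-p2, V2:
`IsScalarLinear`, `galoisCohomology.moduleH1`) and is NOT duplicated here.  A coefficient-ring
object over a DVR or `Λ` (compact, not discrete) enters through the π-adic tower of its finite
levels (§F), with `H¹_F(K, T) = lim` PINNED as the group of compatible families.

## Contents
* A. `IsCoefficientRing p R` (arXiv p. 4, L47–52), `IsPrincipalArtinianOfLength R k` (Rem. 1.1.4).
* B. Local conditions (Def. 1.1.1): relaxed / strict / unramified = finite, singular quotient (tree),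
  propagation to a submodule / a quotient along a `Γ`-equivariant map; Howard's transverse
  condition at a degree-two prime (§1.2, arXiv p. 6 L84–95) through the tree's `ringClassSubgroup`.
* C. Howard Selmer structures (Def. 1.1.10): the tree's `SelmerStructure` + the finite set `Σ(F)`
  with Howard's three containment clauses; the Selmer module is the tree's `selmerGroup`.
* D. Degree-two primes `𝓛₀(T)`, the ideals `I_ℓ`, the sets `𝓛_k(T)`, the groups `G_ℓ = k_λˣ/k_ℓˣ`,
  levels `𝓝(𝓛)` and `I_n` (Def. 1.2.1); Selmer triples `(T, F, 𝓛)` and `F^a_b(c)` (Def. 1.2.2).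
* E. `Quot(T)` (Def. 1.1.3) as PRESENTATIONS `IsQuotientBy ρ I ρI π` of the quotients `T/IT`, their
  morphisms, transition maps, propagated structures; «cartesian on `Quot(T)`» (Def. 1.1.2) verbatim.
* F. π-adic towers `AdicTower` and the limit modules `limitH1`, `limitSelmer` (§1.6, arXiv p. 12).
* G. `G_n = ⊗_{ℓ∣n} G_ℓ` (`PiTensorProduct`, `G_1 = ℤ`, `G_{nℓ} ≅ G_n ⊗ G_ℓ`), level presentations
  `LevelData` with the finite–singular SLOT `fs`, the two paths of display (ks relations), and the
  `G_n`-twisted Kolyvagin systems `IsKolyvaginSystem` / `KS(T, F, 𝓛)` (Def. 1.2.3).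
* H. Hypotheses H.0–H.5 (§1.3) as `Prop`s: `ConjugationDatum` (a complex conjugation `τ` of `K̄`,
  tree `IsLiftOfAut`, with the local transports `Γ_{K_v} → Γ_{K_v̄}` it induces up to the stated
  inner ambiguity), `twist` = `Tw(T)`, `transportH1 : H¹(K_v̄, T) → H¹(K_v, Tw T)`, `H0`–`H3`,
  `DualityDatum` (H.4: the module pairing into `R(1)`, `R(1)` pinned by `twistOne_apply`, the
  INDUCED local cup-product pairings `localCup`, self-orthogonality `IsSelfOrthogonal`),
  `ResidualTau` + `H5a`/`H5b`/`H5c`, and the bundle `SatisfiesH`.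
READING NOTES (where the Lean text is a reading of the print, each flagged at its docstring):
(i) `fs` is a slot, as in the tree's `KolyvaginDatum.fs` — Howard's canonical finite–singular
isomorphism is to be pinned by a predicate where a theorem consumes `KS`; (ii) H.4/H.5(b) are
stated at the FINITE places — in the source `K` is imaginary quadratic, `Γ_{K_v}` is trivial at the
complex place and the clauses there are automatic; (iii) Howard's local pairing is valued in `R`
after `inv_v`, here in `H²(K_v, R(1))` before it (same orthogonal complements, `inv_v` injective);
(iv) `(T*, F*)` is a second instance of `SatisfiesH`, not bundled.
-/

set_option autoImplicit false

noncomputable section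

open Function NumberField IsDedekindDomain Field
open scoped NumberField ContRepresentation Classical

universe u

namespace Literature.NumberTheory.GaloisCohomology.Howard2004

open Literature.NumberTheory.GaloisRepresentations
open Literature.NumberTheory.GaloisRepresentations.DiscreteGaloisModule

/-! ## A. Coefficient rings (arXiv:1202.6340 p. 4, L47–52; Rem. 2.1.4) -/

/-- **Howard's coefficient rings.** «By a coefficient ring, `R`, we mean a complete, Noetherian,
local ring with finite residue field of characteristic `p`.  The cases of interest are when `R` is
the ring of integers `𝒪` of a finite extension of `ℚ_p`, a quotient of `𝒪`, or the Iwasawa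
algebra `Λ`.»  Recorded as a `Prop` (no instance): local, Noetherian, `𝔪`-adically complete,
finite residue field, of characteristic `p`.
[cite: Howard2004HeegnerKolyvagin, §1 conventions (arXiv:1202.6340 p. 4, L47–52)] -/
structure IsCoefficientRing (p : ℕ) (R : Type*) [CommRing R] [IsLocalRing R] : Prop where
  isNoetherianRing : IsNoetherianRing R
  isAdicComplete : IsAdicComplete (IsLocalRing.maximalIdeal R) R
  finite_residueField : Finite (IsLocalRing.ResidueField R)
  charP_residueField : CharP (IsLocalRing.ResidueField R) p

/-- **Principal Artinian coefficient ring of length `k`** («Of special interest is the case where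
`R` is principal and Artinian of length `k` … Let `𝔪 = πR` be the maximal ideal of `R`»): the
maximal ideal is principal, `𝔪^k = 0` and `𝔪^(k-1) ≠ 0`.  A hypothesis, never an instance.
[cite: Howard2004HeegnerKolyvagin, Rem. 1.1.4 (arXiv Rem. 2.1.4, p. 5)] -/
structure IsPrincipalArtinianOfLength (R : Type*) [CommRing R] [IsLocalRing R] (k : ℕ) :
    Prop where
  principal : (IsLocalRing.maximalIdeal R).IsPrincipal
  pow_eq_bot : IsLocalRing.maximalIdeal R ^ k = ⊥
  pow_pred_ne_bot : 0 < k → IsLocalRing.maximalIdeal R ^ (k - 1) ≠ ⊥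

/-! ## B. Local conditions (Def. 1.1.1; arXiv Def. 2.1.1, p. 5) -/

section Local

variable {F : Type u} [Field F] {M : Type u} [AddCommGroup M] [TopologicalSpace M]
  [DiscreteTopology M] {M' : Type u} [AddCommGroup M'] [TopologicalSpace M'] [DiscreteTopology M']

/-- A **local condition** on `T` over the local field `F = K_v`: «a choice of `R`-submodule of
`H¹(K_v, T)`».  In the tree's `ℤ`-linear layer this is an additive subgroup of `H¹(K_v, T)`; that it
is an `R`-submodule (stable under the scalar action of `R` on `H¹`) is a separate predicate on the
shared `R`-action layer (V2) and is not re-defined here.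
[cite: Howard2004HeegnerKolyvagin, Def. 1.1.1 (arXiv Def. 2.1.1, p. 5)] -/
abbrev LocalCondition (ρ : DiscreteGaloisModule F M) : Type u :=
  AddSubgroup (galoisCohomology ρ 1)

/-- The **relaxed** condition `H¹_relaxed(K_v, T) = H¹(K_v, T)`.
[cite: Howard2004HeegnerKolyvagin, Def. 1.1.1 (arXiv p. 5, L45–48)] -/
abbrev relaxedCondition (ρ : DiscreteGaloisModule F M) : LocalCondition ρ := ⊤

/-- The **strict** condition `H¹_strict(K_v, T) = 0`.
[cite: Howard2004HeegnerKolyvagin, Def. 1.1.1 (arXiv p. 5, L45–48)] -/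
abbrev strictCondition (ρ : DiscreteGaloisModule F M) : LocalCondition ρ := ⊥

/-- **Propagation to a submodule** (or along any `Γ_{K_v}`-equivariant map INTO `T`): «Given an
`R[[G_{K_v}]]`-submodule `S` of `T` and a local condition `F` on `T` we define the propagated
condition … on `S` to be the preimage of `H¹_F(K_v, T)` under the natural map `H¹(K_v, S) → H¹(K_v, T)`».
[cite: Howard2004HeegnerKolyvagin, Def. 1.1.1 (arXiv p. 5, L36–44)] -/
def propagatePreimage {ρ' : DiscreteGaloisModule F M'} {ρ : DiscreteGaloisModule F M}
    (f : ρ'.toContRepresentation →ⁱL ρ.toContRepresentation) (L : LocalCondition ρ) :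
    LocalCondition ρ' :=
  L.comap (galoisCohomology.map f 1)

/-- Membership in the condition propagated to a submodule. [cite: Howard2004HeegnerKolyvagin, Def. 1.1.1 (arXiv p. 5, L36–44)] -/
@[simp] theorem mem_propagatePreimage_iff {ρ' : DiscreteGaloisModule F M'}
    {ρ : DiscreteGaloisModule F M} (f : ρ'.toContRepresentation →ⁱL ρ.toContRepresentation)
    (L : LocalCondition ρ) (c : galoisCohomology ρ' 1) :
    c ∈ propagatePreimage f L ↔ galoisCohomology.map f 1 c ∈ L :=
  Iff.rfl

/-- **Propagation to a quotient** (or along any `Γ_{K_v}`-equivariant map OUT OF `T`): «(resp.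
quotient) … (resp. image) of `H¹_F(K_v, T)` under … `H¹(K_v, T) → H¹(K_v, S)`».
[cite: Howard2004HeegnerKolyvagin, Def. 1.1.1 (arXiv p. 5, L36–44)] -/
def propagateImage {ρ : DiscreteGaloisModule F M} {ρ'' : DiscreteGaloisModule F M'}
    (g : ρ.toContRepresentation →ⁱL ρ''.toContRepresentation) (L : LocalCondition ρ) :
    LocalCondition ρ'' :=
  L.map (galoisCohomology.map g 1)

/-- Membership in the condition propagated to a quotient. [cite: Howard2004HeegnerKolyvagin, Def. 1.1.1 (arXiv p. 5, L36–44)] -/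
theorem mem_propagateImage_iff {ρ : DiscreteGaloisModule F M} {ρ'' : DiscreteGaloisModule F M'}
    (g : ρ.toContRepresentation →ⁱL ρ''.toContRepresentation) (L : LocalCondition ρ)
    (c : galoisCohomology ρ'' 1) :
    c ∈ propagateImage g L ↔ ∃ b ∈ L, galoisCohomology.map g 1 b = c :=
  AddSubgroup.mem_map

variable [ValuativeRel F]

/-- The **unramified** condition `H¹_ur(K_v, T) = ker (H¹(K_v, T) → H¹(K_v^{ur}, T))` — the tree's
`DiscreteGaloisModule.unramifiedSubgroup`. [cite: Howard2004HeegnerKolyvagin, Def. 1.1.1 (arXiv p. 5, L49–51)] -/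
abbrev unramifiedCondition (ρ : DiscreteGaloisModule F M) : LocalCondition ρ :=
  unramifiedSubgroup ρ 1

/-- The **finite** condition `H¹_f(K_v, T)`: «If `K_v` has residue characteristic different from `p`
and `T` is unramified … we shall also refer to the unramified condition on `T` as the finite
condition» — by definition the unramified condition; the two hypotheses are recorded where USED,
not baked in (the definition is the same subgroup).  The singular quotient `H¹_s = H¹/H¹_f` is the
tree's `SingularQuotient`/`singularMap`.
[cite: Howard2004HeegnerKolyvagin, Def. 1.1.1 (arXiv p. 5, L58–70)] -/
abbrev finiteCondition (ρ : DiscreteGaloisModule F M) : LocalCondition ρ :=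
  unramifiedSubgroup ρ 1

end Local

/-! ## B′. Howard's transverse condition at a degree-two prime (§1.2; arXiv p. 6, L84–95)

«For `ℓ ∣ λ ∈ 𝓛₀` we denote by `K[ℓ]` the ring class field of conductor `ℓ`.  Since `λ` splits
completely in the Hilbert class field of `K`, the maximal `p`-subextension of the local extension
`K[ℓ]_λ/K_λ` (call it `L`) is a maximal totally tamely ramified abelian `p`-extension of `K_λ` … We
therefore have for such a `λ` a canonical choice of `L`-transverse condition … `H¹_tr(K_ℓ, T)`.»
The tree's `cyclotomicTransverse` (`K_v(μ_{Nv})`) is Mazur–Rubin's choice over `ℚ` and is NOT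
Howard's `L`; Howard's `L` is cut out below, inside `Γ_{K_λ}`, from the tree's ring class subgroup
`ringClassSubgroup K ℓ jbar ≤ Γ_K` (HeegnerModuleIndex): `Γ_L ≤ Γ_{K_λ}` is generated by the elements
whose image in `Γ_{K_λ}/(Γ_{K_λ} ∩ Γ_{K[ℓ]})` (= `Gal(K[ℓ]_λ/K_λ)`, cyclic) has order prime to `p`. -/

section Transverse

variable {K : Type} [Field K] [NumberField K] {M : Type} [AddCommGroup M] [TopologicalSpace M]
  [DiscreteTopology M]

/-- The subgroup `Γ_{K_λ} ∩ Γ_{K[c]}` of the local absolute Galois group at the finite place `λ`: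
the elements whose restriction to `K̄` (`absGaloisRestrict`) fixes the ring class field `K[c]`
(`ringClassSubgroup K c jbar`).  Its fixed field is the completion `K[c]_λ`.
[cite: Howard2004HeegnerKolyvagin, §1.2 (arXiv p. 6, L84–90)] -/
def localRingClassSubgroup (c : ℕ) (jbar : AlgebraicClosure K →+* ℂ)
    (v : HeightOneSpectrum (𝓞 K)) : Subgroup (absoluteGaloisGroup (v.adicCompletion K)) :=
  (Literature.NumberTheory.EllipticCurves.ringClassSubgroup (K := K) c jbar).comap
    (absGaloisRestrict K (v.adicCompletion K)).toMonoidHom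

/-- `Γ_L ≤ Γ_{K_λ}` for Howard's `L` = the maximal `p`-subextension of `K[ℓ]_λ/K_λ`: the subgroup
generated by the `σ ∈ Γ_{K_λ}` some prime-to-`p` power of which fixes `K[ℓ]` (i.e. whose image in
the cyclic group `Gal(K[ℓ]_λ/K_λ)` has order prime to `p`).
[cite: Howard2004HeegnerKolyvagin, §1.2 (arXiv p. 6, L86–92)] -/
def transverseFixer (p : ℕ) [Fact p.Prime] (ℓ : ℕ) (jbar : AlgebraicClosure K →+* ℂ)
    (v : HeightOneSpectrum (𝓞 K)) : Subgroup (absoluteGaloisGroup (v.adicCompletion K)) :=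
  Subgroup.closure
    {σ | ∃ k : ℕ, Nat.Coprime k p ∧ σ ^ k ∈ localRingClassSubgroup ℓ jbar v}

/-- Elements of `Γ_{K_λ} ∩ Γ_{K[ℓ]}` lie in `Γ_L` (take `k = 1`). [cite: Howard2004HeegnerKolyvagin, §1.2 (arXiv p. 6, L86–92)] -/
theorem localRingClassSubgroup_le_transverseFixer (p : ℕ) [Fact p.Prime] (ℓ : ℕ)
    (jbar : AlgebraicClosure K →+* ℂ) (v : HeightOneSpectrum (𝓞 K)) :
    localRingClassSubgroup ℓ jbar v ≤ transverseFixer p ℓ jbar v := fun σ hσ =>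
  Subgroup.subset_closure ⟨1, Nat.coprime_one_left p, by simpa using hσ⟩

/-- **Howard's transverse condition** `H¹_tr(K_ℓ, T) = ker (H¹(K_λ, T) → H¹(L, T))`, `L` the maximal
`p`-subextension of `K[ℓ]_λ/K_λ`: the kernel of the restriction (`resSubgroup`) to `Γ_L ≤ Γ_{K_λ}`
(`transverseFixer`) on the local module `T|_{Γ_{K_λ}}` (`GaloisRep.toLocal`).
[cite: Howard2004HeegnerKolyvagin, §1.1 transverse condition (arXiv p. 5, L52–56) and §1.2 (p. 6, L84–95)] -/
def transverseCondition (p : ℕ) [Fact p.Prime] (ρ : DiscreteGaloisModule K M) (ℓ : ℕ)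
    (jbar : AlgebraicClosure K →+* ℂ) (v : HeightOneSpectrum (𝓞 K)) :
    AddSubgroup (galoisCohomology (GaloisRep.toLocal v ρ) 1) :=
  (resSubgroup (DiscreteGaloisModule.toTopRep (GaloisRep.toLocal v ρ))
      (transverseFixer p ℓ jbar v) 1).hom.toLinearMap.toAddMonoidHom.ker

/-- Howard's transverse conditions as a tree `SelmerStructure` (no condition at infinite places,
`H¹_tr` at every finite place; only the values at the primes of `c` are ever used, through
`SelmerStructure.modify`).  `ℓ` at the finite place `λ` is its residue characteristic.
[cite: Howard2004HeegnerKolyvagin, Def. 1.2.2 (arXiv Def. 2.2.2, p. 6)] -/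
def transverseStructure (p : ℕ) [Fact p.Prime] (ρ : DiscreteGaloisModule K M)
    (jbar : AlgebraicClosure K →+* ℂ) : SelmerStructure ρ := fun v =>
  match v with
  | Sum.inl _ => ⊥
  | Sum.inr q => transverseCondition p ρ (ringChar (𝓞 K ⧸ q.asIdeal)) jbar q

/-- Unfolding the transverse structure at a finite place. [cite: Howard2004HeegnerKolyvagin, Def. 1.2.2 (arXiv p. 6)] -/
theorem transverseStructure_inr (p : ℕ) [Fact p.Prime] (ρ : DiscreteGaloisModule K M)
    (jbar : AlgebraicClosure K →+* ℂ) (q : HeightOneSpectrum (𝓞 K)) :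
    transverseStructure p ρ jbar (Sum.inr q) =
      transverseCondition p ρ (ringChar (𝓞 K ⧸ q.asIdeal)) jbar q := rfl

end Transverse

/-! ## C. Selmer structures in Howard's sense (Def. 1.1.10; arXiv Def. 2.1.10, p. 6, L10–33) -/

section SelmerData

variable {K : Type} [Field K] [NumberField K] {M : Type} [AddCommGroup M] [TopologicalSpace M]
  [DiscreteTopology M]

/-- **A Selmer structure on `T` in Howard's sense**: «a finite set of places `Σ(F)` of `K` containing
`p`, all archimedean places, and all places at which `T` is ramified, and for each `v ∈ Σ(F)` a
choice of local condition `H¹_F(K_v, T)`»; outside `Σ(F)` the condition is the finite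
(= unramified) one («we will usually write `H¹_F(K_v,T)` for `H¹_f(K_v,T)` for a prime
`v ∉ Σ(F)`»).  Typed as a PREDICATE on a tree `SelmerStructure` (a local condition at EVERY place)
and a finite set `Sigma`: the tree's `IsUnramifiedOutside` (archimedean places in `Σ`, `H¹_ur`
outside) plus Howard's two further containment clauses.
[cite: Howard2004HeegnerKolyvagin, Def. 1.1.10 (arXiv Def. 2.1.10, p. 6, L10–24)] -/
structure IsHowardSelmerStructure (p : ℕ) {ρ : DiscreteGaloisModule K M} (𝓕 : SelmerStructure ρ)
    (Sigma : Finset (Place K)) : Prop where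
  isUnramifiedOutside : 𝓕.IsUnramifiedOutside Sigma
  mem_of_dvd : ∀ v : HeightOneSpectrum (𝓞 K), ((p : ℕ) : 𝓞 K) ∈ v.asIdeal → (Sum.inr v : Place K) ∈ Sigma
  mem_of_ramified : ∀ v : HeightOneSpectrum (𝓞 K), ¬ GaloisRep.IsUnramifiedAt v ρ →
    (Sum.inr v : Place K) ∈ Sigma

/-- The **Selmer module** `H¹_F(K, T)` «is nothing more than the set of classes in `H¹(K, T)` whose
localization lives in `H¹_F(K_v, T)` at every place `v`» — the tree's `SelmerStructure.selmerGroup`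
(Howard's definition as the kernel of `H¹(K_Σ/K, T) → ⊕_{v ∈ Σ} H¹(K_v,T)/H¹_F(K_v,T)` is the same
group by his own remark).
[cite: Howard2004HeegnerKolyvagin, Def. 1.1.10 (arXiv p. 6, L14–24)] -/
abbrev selmerModule {ρ : DiscreteGaloisModule K M} (𝓕 : SelmerStructure ρ) :
    AddSubgroup (galoisCohomology ρ 1) :=
  𝓕.selmerGroup

/-- The partial order «`F ≤ F′` iff `H¹_F(K_v,T) ⊂ H¹_{F′}(K_v,T)` for every place `v`» is the tree's
order on `SelmerStructure` (pointwise); «clearly if `F ≤ F′` we have `H¹_F(K,T) ⊂ H¹_{F′}(K,T)`».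
[cite: Howard2004HeegnerKolyvagin, Def. 1.1.10 (arXiv p. 6, L25–28)] -/
theorem selmerModule_mono {ρ : DiscreteGaloisModule K M} {𝓕 𝓕' : SelmerStructure ρ} (h : 𝓕 ≤ 𝓕') :
    selmerModule 𝓕 ≤ selmerModule 𝓕' := by
  intro c hc
  rw [selmerModule, SelmerStructure.mem_selmerGroup_iff] at hc ⊢
  exact fun v => h v (hc v)

end SelmerData

/-! ## D. Kolyvagin primes, `I_ℓ`, `𝓛_k(T)`, `G_ℓ`, levels, Selmer triples (Def. 1.2.1–1.2.2; arXiv p. 6, L57–125) -/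

section Primes

variable {K : Type} [Field K] [NumberField K] {M : Type} [AddCommGroup M] [TopologicalSpace M]
  [DiscreteTopology M]

/-- The residue characteristic `ℓ` of the finite place `λ` («we will consistently confuse a prime of
`𝓛₀` with the rational prime below it»). [cite: Howard2004HeegnerKolyvagin, §1.2 (arXiv p. 6, L57–62)] -/
def residueChar (v : HeightOneSpectrum (𝓞 K)) : ℕ := ringChar (𝓞 K ⧸ v.asIdeal)

/-- `λ` is a **degree-two prime** of `K`: its residue field `k_λ` has `ℓ²` elements, `ℓ` the
residue characteristic (for `K` imaginary quadratic: `ℓ` is inert in `K`).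
[cite: Howard2004HeegnerKolyvagin, §1.2 (arXiv p. 6, L57–58)] -/
def IsDegreeTwo (v : HeightOneSpectrum (𝓞 K)) : Prop :=
  Nat.card (𝓞 K ⧸ v.asIdeal) = residueChar v ^ 2

/-- **`𝓛₀ = 𝓛₀(T)`**: «the set of degree two primes of `K` which do not divide `p` or any prime at
which `T` is ramified» (read: `λ ∤ p` and `T` is unramified at `λ`).
[cite: Howard2004HeegnerKolyvagin, §1.2 (arXiv p. 6, L57–60)] -/
def degreeTwoPrimes (p : ℕ) (ρ : DiscreteGaloisModule K M) : Set (HeightOneSpectrum (𝓞 K)) :=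
  {v | IsDegreeTwo v ∧ ((p : ℕ) : 𝓞 K) ∉ v.asIdeal ∧ GaloisRep.IsUnramifiedAt v ρ}

variable {R : Type} [CommRing R] [Module R M]

/-- **`I_ℓ`**: «the smallest ideal of `R` containing `ℓ + 1` for which `Frob_λ` acts trivially on
`T/I_ℓ T`» — the infimum of the ideals `I ∋ ℓ + 1` such that `Frob_λ m - m ∈ I·T` for every
`m ∈ T` and every arithmetic Frobenius `Frob_λ` at `λ` (`IsArithFrobAtPlace`; `T` unramified at
`λ ∈ 𝓛₀`, so the choice of Frobenius is immaterial there).  Needs only the `R`-module structure of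
`T = M`.
[cite: Howard2004HeegnerKolyvagin, Def. 1.2.1 (arXiv Def. 2.2.1, p. 6, L63–66)] -/
def frobIdeal (ρ : DiscreteGaloisModule K M) (v : HeightOneSpectrum (𝓞 K)) : Ideal R :=
  sInf {I : Ideal R | ((residueChar v + 1 : ℕ) : R) ∈ I ∧
    ∀ σ : absoluteGaloisGroup K, IsArithFrobAtPlace K v σ →
      ∀ m : M, ρ σ m - m ∈ (I • (⊤ : Submodule R M) : Submodule R M)}

/-- `ℓ + 1 ∈ I_ℓ`. [cite: Howard2004HeegnerKolyvagin, Def. 1.2.1 (arXiv p. 6, L63–66)] -/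
theorem natCast_residueChar_add_one_mem_frobIdeal (ρ : DiscreteGaloisModule K M)
    (v : HeightOneSpectrum (𝓞 K)) :
    ((residueChar v + 1 : ℕ) : R) ∈ frobIdeal (R := R) ρ v := by
  simp only [frobIdeal, Submodule.mem_sInf, Set.mem_setOf_eq]
  exact fun I hI => hI.1

/-- **`𝓛_k = 𝓛_k(T) = {ℓ ∈ 𝓛₀ | I_ℓ ⊂ p^k ℤ_p}`** (read in `R`: `I_ℓ ≤ p^k R`).
[cite: Howard2004HeegnerKolyvagin, Def. 1.2.1 (arXiv p. 6, L67–68)] -/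
def kolyvaginPrimes (p : ℕ) (ρ : DiscreteGaloisModule K M) (k : ℕ) :
    Set (HeightOneSpectrum (𝓞 K)) :=
  {v | v ∈ degreeTwoPrimes p ρ ∧ frobIdeal (R := R) ρ v ≤ Ideal.span {((p : ℕ) : R) ^ k}}

/-- `𝓛_k ⊆ 𝓛₀`. [cite: Howard2004HeegnerKolyvagin, Def. 1.2.1 (arXiv p. 6, L67–68)] -/
theorem kolyvaginPrimes_subset (p : ℕ) (ρ : DiscreteGaloisModule K M) (k : ℕ) :
    kolyvaginPrimes (R := R) p ρ k ⊆ degreeTwoPrimes p ρ := fun _ hv => hv.1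

/-- The embedding `k_ℓˣ = 𝔽_ℓˣ ↪ k_λˣ` of the units of the prime field into the units of the residue
field at `λ` (`ZMod.castHom` along the residue characteristic). [folklore] -/
def primeFieldUnitsHom (v : HeightOneSpectrum (𝓞 K)) :
    (ZMod (residueChar v))ˣ →* (𝓞 K ⧸ v.asIdeal)ˣ :=
  Units.map (ZMod.castHom (dvd_refl (residueChar v)) (𝓞 K ⧸ v.asIdeal)).toMonoidHom

/-- **`G_ℓ = k_λˣ / k_ℓˣ`** (cyclic of order `ℓ + 1` at a degree-two prime), written additively so
that it can be tensored with cohomology groups (`G_n = ⊗_{ℓ ∣ n} G_ℓ`, `G_1 = ℤ`, tranche 2).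
[cite: Howard2004HeegnerKolyvagin, Def. 1.2.1 (arXiv p. 6, L69–72)] -/
abbrev Gell (v : HeightOneSpectrum (𝓞 K)) : Type :=
  Additive (𝓞 K ⧸ v.asIdeal)ˣ ⧸ (primeFieldUnitsHom v).range.toAddSubgroup

/-- **Levels `𝓝 = 𝓝(𝓛)`**: «the set of squarefree products of primes of `𝓛`, with the convention that
`1 ∈ 𝓝(𝓛)`» — finite sets of primes of `𝓛` (the empty set is `n = 1`).
[cite: Howard2004HeegnerKolyvagin, §1.2 (arXiv p. 6, L73–75 and L98–100)] -/
def levels (P : Set (HeightOneSpectrum (𝓞 K))) : Set (Finset (HeightOneSpectrum (𝓞 K))) :=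
  {n | ↑n ⊆ P}

omit [NumberField K] in
/-- `1 ∈ 𝓝(𝓛)` (the empty product). [cite: Howard2004HeegnerKolyvagin, Def. 1.2.1 (arXiv p. 6, L74–75)] -/
@[simp] theorem empty_mem_levels (P : Set (HeightOneSpectrum (𝓞 K))) : (∅ : Finset _) ∈ levels P := by
  simp [levels]

/-- **`I_n = Σ_{ℓ ∣ n} I_ℓ`** (so `I_1 = 0`). [cite: Howard2004HeegnerKolyvagin, Def. 1.2.1 (arXiv p. 6, L73–75)] -/
def levelIdeal (ρ : DiscreteGaloisModule K M) (n : Finset (HeightOneSpectrum (𝓞 K))) : Ideal R :=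
  ⨆ v ∈ n, frobIdeal (R := R) ρ v

/-- `I_1 = 0`. [cite: Howard2004HeegnerKolyvagin, Def. 1.2.1 (arXiv p. 6, L74–75)] -/
@[simp] theorem levelIdeal_empty (ρ : DiscreteGaloisModule K M) :
    levelIdeal (R := R) ρ ∅ = ⊥ := by
  simp [levelIdeal]

/-- `I_ℓ ≤ I_n` for `ℓ ∣ n`. [cite: Howard2004HeegnerKolyvagin, Def. 1.2.1 (arXiv p. 6, L73–75)] -/
theorem frobIdeal_le_levelIdeal (ρ : DiscreteGaloisModule K M) {n : Finset (HeightOneSpectrum (𝓞 K))}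
    {v : HeightOneSpectrum (𝓞 K)} (hv : v ∈ n) :
    frobIdeal (R := R) ρ v ≤ levelIdeal (R := R) ρ n :=
  le_iSup₂ (f := fun w _ => frobIdeal (R := R) ρ w) v hv

/-- `I_n ≤ I_{n'}` for `n ∣ n'`. [cite: Howard2004HeegnerKolyvagin, Def. 1.2.1 (arXiv p. 6, L73–75)] -/
theorem levelIdeal_mono (ρ : DiscreteGaloisModule K M) {n n' : Finset (HeightOneSpectrum (𝓞 K))}
    (h : n ⊆ n') : levelIdeal (R := R) ρ n ≤ levelIdeal (R := R) ρ n' :=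
  iSup₂_le fun _ hv => frobIdeal_le_levelIdeal (R := R) ρ (h hv)

/-- **A Selmer triple `(T, F, 𝓛)`**: «an object `T` of `Mod_{R,K}`, a choice of Selmer structure `F`
on `T`, and a (typically infinite) subset `𝓛 ⊂ 𝓛₀` which is disjoint from `Σ(F)`».  The module `T`
(`ρ`) is a parameter; the structure bundles `F` (tree `SelmerStructure` + Howard's `Σ(F)`) and `𝓛`.
[cite: Howard2004HeegnerKolyvagin, §1.2 (arXiv p. 6, L96–100)] -/
structure SelmerTriple (p : ℕ) (ρ : DiscreteGaloisModule K M) where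
  /-- the local conditions, one at every place (tree `SelmerStructure`) -/
  cond : SelmerStructure ρ
  /-- Howard's finite set `Σ(F)` -/
  Sigma : Finset (Place K)
  /-- `(cond, Sigma)` is a Selmer structure in Howard's sense (Def. 1.1.10) -/
  isHoward : IsHowardSelmerStructure p cond Sigma
  /-- the set `𝓛` of Kolyvagin primes -/
  primes : Set (HeightOneSpectrum (𝓞 K))
  /-- `𝓛 ⊂ 𝓛₀(T)` -/
  primes_subset : primes ⊆ degreeTwoPrimes p ρ
  /-- `𝓛` is disjoint from `Σ(F)` -/
  disjoint : ∀ v ∈ primes, (Sum.inr v : Place K) ∉ Sigma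

namespace SelmerTriple

variable {p : ℕ} {ρ : DiscreteGaloisModule K M}

/-- `𝓝(𝓛)` of a Selmer triple. [cite: Howard2004HeegnerKolyvagin, §1.2 (arXiv p. 6, L98–100)] -/
abbrev levelSet (t : SelmerTriple p ρ) : Set (Finset (HeightOneSpectrum (𝓞 K))) := levels t.primes

/-- At a Kolyvagin prime the condition of the triple is the finite one (`𝓛 ∩ Σ(F) = ∅` and `F` is
unramified outside `Σ(F)`). [cite: Howard2004HeegnerKolyvagin, Def. 1.1.10 + §1.2 (arXiv p. 6)] -/
theorem cond_inr_eq_of_mem (t : SelmerTriple p ρ) {v : HeightOneSpectrum (𝓞 K)} (hv : v ∈ t.primes) :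
    t.cond (Sum.inr v) = unramifiedSubgroup (GaloisRep.toLocal v ρ) 1 :=
  t.isHoward.isUnramifiedOutside.2 v (t.disjoint v hv)

/-- **The modified triple `(T, F^a_b(c), 𝓛(abc))`** (Def. 1.2.2): `Σ(F^a_b(c)) = Σ(F) ∪ {λ ∣ abc}`,
relaxed at `a`, strict at `b`, Howard-transverse at `c`, unchanged elsewhere (tree
`SelmerStructure.modify` with `𝒯 = transverseStructure`), and `𝓛(abc) = 𝓛` minus the primes of
`abc`.  (`a b c ∈ 𝓝(𝓛)` in the source; the definition makes sense for any finite sets of primes and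
the membership is carried by the lemmas that need it.)
[cite: Howard2004HeegnerKolyvagin, Def. 1.2.2 (arXiv Def. 2.2.2, p. 6, L101–125)] -/
def modify [Fact p.Prime] (t : SelmerTriple p ρ) (jbar : AlgebraicClosure K →+* ℂ)
    (a b c : Finset (HeightOneSpectrum (𝓞 K))) : SelmerTriple p ρ where
  cond := t.cond.modify (transverseStructure p ρ jbar) a b c
  Sigma := t.Sigma ∪ (a ∪ b ∪ c).image Sum.inr
  isHoward :=
    { isUnramifiedOutside := by
        refine ⟨fun w => Finset.mem_union_left _ (t.isHoward.isUnramifiedOutside.1 w), fun v hv => ?_⟩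
        simp only [Finset.mem_union, Finset.mem_image, Sum.inr.injEq, exists_eq_right, not_or] at hv
        obtain ⟨hvS, ⟨hva, hvb⟩, hvc⟩ := hv
        rw [SelmerStructure.modify_inr, if_neg hva, if_neg hvb, if_neg hvc]
        exact t.isHoward.isUnramifiedOutside.2 v hvS
      mem_of_dvd := fun v hv => Finset.mem_union_left _ (t.isHoward.mem_of_dvd v hv)
      mem_of_ramified := fun v hv => Finset.mem_union_left _ (t.isHoward.mem_of_ramified v hv) }
  primes := t.primes \ ↑(a ∪ b ∪ c)
  primes_subset := fun _ hv => t.primes_subset hv.1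
  disjoint := by
    rintro v ⟨hvP, hvabc⟩ hmem
    rcases Finset.mem_union.mp hmem with hS | h
    · exact t.disjoint v hvP hS
    · exact hvabc (Finset.mem_coe.mpr ((Sum.inr_injective.mem_finset_image).mp h))

/-- `F(n) := F^∅_∅(n)` — the transverse modification at the primes of `n` only (the structure in which
the Kolyvagin classes `κ_n` live, Def. 1.2.3). [cite: Howard2004HeegnerKolyvagin, Def. 1.2.2 (arXiv p. 6, L121–125)] -/
def atLevel [Fact p.Prime] (t : SelmerTriple p ρ) (jbar : AlgebraicClosure K →+* ℂ)
    (n : Finset (HeightOneSpectrum (𝓞 K))) : SelmerTriple p ρ :=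
  t.modify jbar ∅ ∅ n

/-- At a prime of `n` the condition of `F(n)` is Howard's transverse one.
[cite: Howard2004HeegnerKolyvagin, Def. 1.2.2 (arXiv p. 6, L110–120)] -/
theorem atLevel_cond_inr_of_mem [Fact p.Prime] (t : SelmerTriple p ρ) (jbar : AlgebraicClosure K →+* ℂ)
    {n : Finset (HeightOneSpectrum (𝓞 K))} {v : HeightOneSpectrum (𝓞 K)} (hv : v ∈ n) :
    (t.atLevel jbar n).cond (Sum.inr v) = transverseCondition p ρ (residueChar v) jbar v := by
  change (t.cond.modify (transverseStructure p ρ jbar) ∅ ∅ n) (Sum.inr v) = _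
  rw [SelmerStructure.modify_inr]
  simp [hv, transverseStructure_inr, residueChar]

/-- Away from `n` (at finite places) `F(n)` is `F`. [cite: Howard2004HeegnerKolyvagin, Def. 1.2.2 (arXiv p. 6, L121–123)] -/
theorem atLevel_cond_inr_of_not_mem [Fact p.Prime] (t : SelmerTriple p ρ)
    (jbar : AlgebraicClosure K →+* ℂ) {n : Finset (HeightOneSpectrum (𝓞 K))}
    {v : HeightOneSpectrum (𝓞 K)} (hv : v ∉ n) :
    (t.atLevel jbar n).cond (Sum.inr v) = t.cond (Sum.inr v) := by
  change (t.cond.modify (transverseStructure p ρ jbar) ∅ ∅ n) (Sum.inr v) = _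
  rw [SelmerStructure.modify_inr]
  simp [hv]

end SelmerTriple

end Primes

/-! ## E. Quotients `T/IT` (the category `Quot(T)`, Def. 1.1.3) as PRESENTATIONS; «cartesian»

Howard: «For `T` an object of `Mod_{R,K_v}` we define the quotient category of `T`, `Quot(T)`, to be
the category whose objects are quotients `T/IT` of `T` by ideals of `R` and the morphisms from
`T/IT` to `T/JT` are the maps induced by scalar multiplications `r ∈ R` with `rI ⊂ J`. Any local
condition on `T` defines a local condition functorial over `Quot(T)` by propagation.»
[arXiv Def. 2.1.3, p. 5 L93–99].  An object `T/IT` is recorded as a PRESENTATION — a discrete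
`Γ_K`-module `N` with an `R`-linear `Γ_K`-equivariant surjection `T ↠ N` of kernel `I·T` — i.e. the
object up to its unique isomorphism; this lets every consumer (the D1 tower `T_q/p^k T_q`, the
Kolyvagin levels `T/I_n T`) bring its own carrier type, and declares no instance. -/

section Quot

variable {K : Type} [Field K] [NumberField K] {M : Type} [AddCommGroup M] [TopologicalSpace M]
  [DiscreteTopology M] {R : Type} [CommRing R] [Module R M]
  {N : Type} [AddCommGroup N] [TopologicalSpace N] [DiscreteTopology N] [Module R N]
  {N' : Type} [AddCommGroup N'] [TopologicalSpace N'] [DiscreteTopology N'] [Module R N']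

/-- **`N` presents the quotient `T/IT`** (an object of `Quot(T)`): `π : T →ₗ[R] N` is surjective,
`Γ_K`-equivariant, with kernel `I·T`.
[cite: Howard2004HeegnerKolyvagin, Def. 1.1.3 (arXiv Def. 2.1.3, p. 5, L93–99)] -/
structure IsQuotientBy (ρ : DiscreteGaloisModule K M) (I : Ideal R) (ρI : DiscreteGaloisModule K N)
    (π : M →ₗ[R] N) : Prop where
  surjective : Function.Surjective π
  ker_eq : LinearMap.ker π = I • (⊤ : Submodule R M)
  equivariant : ∀ (σ : absoluteGaloisGroup K) (m : M), π (ρ σ m) = ρI σ (π m)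

namespace IsQuotientBy

variable {ρ : DiscreteGaloisModule K M} {I J : Ideal R} {ρI : DiscreteGaloisModule K N}
  {π : M →ₗ[R] N} {ρJ : DiscreteGaloisModule K N'} {πJ : M →ₗ[R] N'}

/-- The map `Hⁿ(K, T) → Hⁿ(K, T/IT)` induced by the presentation (tree `cohomologyMap`).
[cite: Howard2004HeegnerKolyvagin, Def. 1.1.3 (arXiv p. 5, L93–99)] -/
def cohomologyMap (h : IsQuotientBy ρ I ρI π) (n : ℕ) :
    galoisCohomology ρ n →+ galoisCohomology ρI n :=
  ContinuousRep.cohomologyMap ρ ρI π.toAddMonoidHom continuous_of_discreteTopology h.equivariant n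

/-- The same map between the LOCAL cohomology groups `Hⁿ(K_v, T) → Hⁿ(K_v, T/IT)` at a place `v`
(the presentation restricted to `Γ_{K_v}`). [cite: Howard2004HeegnerKolyvagin, Def. 1.1.1/1.1.3 (arXiv p. 5)] -/
def localCohomologyMap (h : IsQuotientBy ρ I ρI π) (v : Place K) (n : ℕ) :
    galoisCohomology (ρ.toLocal v) n →+ galoisCohomology (ρI.toLocal v) n :=
  ContinuousRep.cohomologyMap (ρ.toLocal v) (ρI.toLocal v) π.toAddMonoidHom
    continuous_of_discreteTopology (fun _ m => h.equivariant _ m) n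

/-- **Propagation of a local condition from `T` to `T/IT`** at a place `v`: its image under
`H¹(K_v, T) → H¹(K_v, T/IT)`. [cite: Howard2004HeegnerKolyvagin, Def. 1.1.3 (arXiv p. 5, L98–99)] -/
def propagate (h : IsQuotientBy ρ I ρI π) (v : Place K)
    (L : AddSubgroup (galoisCohomology (ρ.toLocal v) 1)) :
    AddSubgroup (galoisCohomology (ρI.toLocal v) 1) :=
  L.map (h.localCohomologyMap v 1)

/-- **A Selmer structure propagated to `T/IT`**, place by place («functorial over `Quot(T)` by
propagation»). [cite: Howard2004HeegnerKolyvagin, Def. 1.1.3 and Def. 1.1.10 (arXiv pp. 5–6)] -/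
def propagateStructure (h : IsQuotientBy ρ I ρI π) (𝓕 : SelmerStructure ρ) : SelmerStructure ρI :=
  fun v => h.propagate v (𝓕 v)

/-- Unfolding `propagateStructure`. [cite: Howard2004HeegnerKolyvagin, Def. 1.1.3 (arXiv p. 5)] -/
@[simp] theorem propagateStructure_apply (h : IsQuotientBy ρ I ρI π) (𝓕 : SelmerStructure ρ)
    (v : Place K) : h.propagateStructure 𝓕 v = (𝓕 v).map (h.localCohomologyMap v 1) := rfl

/-- **The morphism `T/IT → T/JT` of `Quot(T)` for `I ⊆ J`** (scalar `r = 1`), on presentations: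
the unique factorisation of `π_J` through `π_I`. [cite: Howard2004HeegnerKolyvagin, Def. 1.1.3 (arXiv p. 5, L95–97)] -/
def transition (hI : IsQuotientBy ρ I ρI π) (hJ : IsQuotientBy ρ J ρJ πJ) (hIJ : I ≤ J) :
    N →ₗ[R] N' :=
  ((LinearMap.ker π).liftQ πJ (by
      rw [hI.ker_eq, hJ.ker_eq]
      exact Submodule.smul_mono_left hIJ)).comp
    (π.quotKerEquivOfSurjective hI.surjective).symm.toLinearMap

omit [NumberField K] in
/-- The transition map is compatible with the two presentations: `trans (π_I m) = π_J m`.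
[cite: Howard2004HeegnerKolyvagin, Def. 1.1.3 (arXiv p. 5, L95–97)] -/
theorem transition_apply (hI : IsQuotientBy ρ I ρI π) (hJ : IsQuotientBy ρ J ρJ πJ) (hIJ : I ≤ J)
    (m : M) : hI.transition hJ hIJ (π m) = πJ m := by
  have h1 : (π.quotKerEquivOfSurjective hI.surjective).symm (π m) = Submodule.Quotient.mk m := by
    rw [LinearEquiv.symm_apply_eq]
    rfl
  simp [transition, h1]

omit [NumberField K] in
/-- The transition map is `Γ_K`-equivariant. [cite: Howard2004HeegnerKolyvagin, Def. 1.1.3 (arXiv p. 5, L95–97)] -/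
theorem transition_equivariant (hI : IsQuotientBy ρ I ρI π) (hJ : IsQuotientBy ρ J ρJ πJ)
    (hIJ : I ≤ J) (σ : absoluteGaloisGroup K) (x : N) :
    hI.transition hJ hIJ (ρI σ x) = ρJ σ (hI.transition hJ hIJ x) := by
  obtain ⟨m, rfl⟩ := hI.surjective x
  rw [← hI.equivariant, transition_apply, transition_apply, hJ.equivariant]

/-- `H¹` of the transition map `T/IT → T/JT`. [cite: Howard2004HeegnerKolyvagin, Def. 1.1.3 (arXiv p. 5)] -/
def transitionH1 (hI : IsQuotientBy ρ I ρI π) (hJ : IsQuotientBy ρ J ρJ πJ) (hIJ : I ≤ J) :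
    galoisCohomology ρI 1 →+ galoisCohomology ρJ 1 :=
  ContinuousRep.cohomologyMap ρI ρJ (hI.transition hJ hIJ).toAddMonoidHom
    continuous_of_discreteTopology (hI.transition_equivariant hJ hIJ) 1

end IsQuotientBy

/-- **A morphism of `Quot(T)`** from `T/IT` to `T/JT`, «induced by scalar multiplication by `r ∈ R`
with `rI ⊂ J`», on presentations: an `R`-linear `Γ_K`-equivariant `f` with `f ∘ π_I = r · π_J`.
[cite: Howard2004HeegnerKolyvagin, Def. 1.1.3 (arXiv Def. 2.1.3, p. 5, L95–97)] -/
structure IsQuotMorphism (ρ : DiscreteGaloisModule K M) (I J : Ideal R)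
    (ρI : DiscreteGaloisModule K N) (πI : M →ₗ[R] N) (ρJ : DiscreteGaloisModule K N')
    (πJ : M →ₗ[R] N') (r : R) (f : N →ₗ[R] N') : Prop where
  smul_le : ∀ x ∈ I, r * x ∈ J
  comp_eq : ∀ m : M, f (πI m) = r • πJ m
  equivariant : ∀ (σ : absoluteGaloisGroup K) (x : N), f (ρI σ x) = ρJ σ (f x)

/-- **`F` is cartesian on `Quot(T)` at the place `v`** (Def. 1.1.2 for the subcategory `Quot(T)`
with its propagated conditions, Def. 1.1.3): for every INJECTIVE morphism `α : T/IT → T/JT` of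
`Quot(T)`, «the local condition on `S = T/IT` is the same as the local condition obtained by
propagating from `T/JT` to `S`», i.e. the condition propagated from `T` to `T/IT` is the preimage
under `H¹(α)` of the condition propagated from `T` to `T/JT`.  Quantified over all presentations.
[cite: Howard2004HeegnerKolyvagin, Def. 1.1.2–1.1.3 (arXiv Def. 2.1.2–2.1.3, p. 5, L88–99)] -/
def IsCartesianOnQuotAt (ρ : DiscreteGaloisModule K M) (R : Type) [CommRing R] [Module R M]
    (v : Place K) (L : AddSubgroup (galoisCohomology (ρ.toLocal v) 1)) : Prop :=
  ∀ (I J : Ideal R) (N N' : Type) [AddCommGroup N] [TopologicalSpace N] [DiscreteTopology N]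
    [Module R N] [AddCommGroup N'] [TopologicalSpace N'] [DiscreteTopology N'] [Module R N']
    (ρI : DiscreteGaloisModule K N) (πI : M →ₗ[R] N) (ρJ : DiscreteGaloisModule K N')
    (πJ : M →ₗ[R] N') (hI : IsQuotientBy ρ I ρI πI) (hJ : IsQuotientBy ρ J ρJ πJ) (r : R)
    (f : N →ₗ[R] N') (hf : IsQuotMorphism ρ I J ρI πI ρJ πJ r f), Function.Injective f →
      hI.propagate v L =
        (hJ.propagate v L).comap
          (ContinuousRep.cohomologyMap (ρI.toLocal v) (ρJ.toLocal v) f.toAddMonoidHom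
            continuous_of_discreteTopology (fun _ x => hf.equivariant _ x) 1)

end Quot

/-! ## F. π-adic towers and the limit Selmer modules `H¹_F(K, T) = lim`, (`H¹_F(K, A) = colim`)

The coefficient-ring object `T` of Thm. 1.6.1 (free of rank two over a discrete valuation ring, or
over `Λ`) is compact, not discrete; it enters the discrete layer through the tower of its finite
levels.  Howard: «`H¹_F(K, T) = lim H¹_F(K, T/𝔪^k T)`, `H¹_F(K, A) = colim`» [arXiv p. 12,
L29–55].  The tower is indexed by `k : ℕ` with `R`-linear reductions `N (k+1) → N k` (the D1
lineage's shape: the levels `T_q/p^k T_q` of the Eisenstein specialisation, `R = Λ/(q_m)`). -/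

section Tower

variable {K : Type} [Field K] [NumberField K] {R : Type} [CommRing R] [IsLocalRing R]

variable (K R) in
/-- **A π-adic tower presenting `T` and its `𝔪`-adic quotients**: levels `(N k, ρ k)` that are
`R`-linear discrete `Γ_K`-modules (x10b-p2's `IsScalarLinear`, the one scalar layer) killed by
SOME power of the maximal ideal, with surjective `R`-linear `Γ_K`-equivariant reductions.
[cite: Howard2004HeegnerKolyvagin, §1.6 (arXiv p. 12, L29–55)] -/
structure AdicTower (N : ℕ → Type) [∀ k, AddCommGroup (N k)] [∀ k, TopologicalSpace (N k)]
    [∀ k, DiscreteTopology (N k)] [∀ k, Module R (N k)] where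
  /-- the Galois action at level `k` -/
  ρ : ∀ k, DiscreteGaloisModule K (N k)
  /-- `R`-linearity of the action at every level -/
  hlin : ∀ k, (ρ k).IsScalarLinear R
  /-- level `k` is killed by some power of `𝔪` -/
  killed : ∀ k, ∃ e : ℕ, ∀ r ∈ IsLocalRing.maximalIdeal R ^ e, ∀ x : N k, r • x = 0
  /-- reduction `N (k+1) → N k` -/
  red : ∀ k, N (k + 1) →ₗ[R] N k
  red_surjective : ∀ k, Function.Surjective (red k)
  red_equivariant : ∀ k (σ : absoluteGaloisGroup K) (x : N (k + 1)),
    red k (ρ (k + 1) σ x) = ρ k σ (red k x)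

namespace AdicTower

variable {N : ℕ → Type} [∀ k, AddCommGroup (N k)] [∀ k, TopologicalSpace (N k)]
  [∀ k, DiscreteTopology (N k)] [∀ k, Module R (N k)]

/-- The reduction on cohomology `H¹(K, T_{k+1}) → H¹(K, T_k)`. [cite: Howard2004HeegnerKolyvagin, §1.6 (arXiv p. 12)] -/
def redH1 (T : AdicTower K R N) (k : ℕ) :
    galoisCohomology (T.ρ (k + 1)) 1 →+ galoisCohomology (T.ρ k) 1 :=
  ContinuousRep.cohomologyMap (T.ρ (k + 1)) (T.ρ k) (T.red k).toAddMonoidHom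
    continuous_of_discreteTopology (T.red_equivariant k) 1

/-- **`H¹(K, T) := lim_k H¹(K, T_k)`**: the subgroup of compatible families in `Π_k H¹(K, T_k)`
(PINNED: literally the inverse-limit set). [cite: Howard2004HeegnerKolyvagin, §1.6 (arXiv p. 12, L29–55)] -/
def limitH1 (T : AdicTower K R N) : AddSubgroup (∀ k, galoisCohomology (T.ρ k) 1) where
  carrier := {x | ∀ k, T.redH1 k (x (k + 1)) = x k}
  add_mem' := by
    intro a b ha hb k
    simp only [Pi.add_apply, map_add, ha k, hb k]
  zero_mem' := by intro k; simp
  neg_mem' := by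
    intro a ha k
    simp only [Pi.neg_apply, map_neg, ha k]

/-- **`H¹_F(K, T) := lim_k H¹_{F_k}(K, T_k)`** for Selmer structures `F_k` on the levels: the
compatible families all of whose components are Selmer classes.
[cite: Howard2004HeegnerKolyvagin, Def. 1.1.10 and §1.6 (arXiv pp. 6, 12)] -/
def limitSelmer (T : AdicTower K R N) (F : ∀ k, SelmerStructure (T.ρ k)) :
    AddSubgroup (∀ k, galoisCohomology (T.ρ k) 1) :=
  T.limitH1 ⊓ AddSubgroup.pi Set.univ fun k => (F k).selmerGroup

/-- Membership in `lim_k H¹_{F_k}(K, T_k)`. [cite: Howard2004HeegnerKolyvagin, §1.6 (arXiv p. 12)] -/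
theorem mem_limitSelmer_iff (T : AdicTower K R N) (F : ∀ k, SelmerStructure (T.ρ k))
    (x : ∀ k, galoisCohomology (T.ρ k) 1) :
    x ∈ T.limitSelmer F ↔ (∀ k, T.redH1 k (x (k + 1)) = x k) ∧ ∀ k, x k ∈ (F k).selmerGroup := by
  simp [limitSelmer, limitH1, AddSubgroup.mem_pi, AddSubgroup.mem_inf]

/-- **A compatible family of Selmer structures on the tower** (`F_{k+1}` maps into `F_k` under the
reduction at every place) — the shape in which a Selmer structure on the compact `T` is seen on
its finite levels; the transition maps of `colim_k H¹_{F_k}(K, T_k) = H¹_F(K, A)` are the maps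
induced by `π : T_k ↪ T_{k+1}`, supplied by the instance (not recorded here).
[cite: Howard2004HeegnerKolyvagin, §1.6 (arXiv p. 12, L29–55)] -/
def IsCompatibleFamily (T : AdicTower K R N) (F : ∀ k, SelmerStructure (T.ρ k)) : Prop :=
  ∀ k (v : Place K), (F (k + 1) v).map
      (ContinuousRep.cohomologyMap ((T.ρ (k + 1)).toLocal v) ((T.ρ k).toLocal v)
        (T.red k).toAddMonoidHom continuous_of_discreteTopology
        (fun _ x => T.red_equivariant k _ x) 1) ≤ F k v

end AdicTower

end Tower

/-! ## G. Kolyvagin systems with the `G_n`-twist (Def. 1.2.3; arXiv Def. 2.2.3, p. 6 L120 – p. 7 L12)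

`G_n = ⊗_{ℓ ∣ n} G_ℓ` (`G_1 = ℤ`) is Mathlib's `PiTensorProduct` over the primes of the level;
`κ_n ∈ H¹_{F(n)}(K, T/I_nT) ⊗ G_n` is an element of the tensor product (over `ℤ`) of the Selmer
SUBGROUP with `G_n`; the objects `T/I_nT` are presentations (§E); the finite–singular comparison
maps `φ^{fs}_ℓ : H¹_f(K_ℓ, T/I_{nℓ}T) ≅ H¹_s(K_ℓ, T/I_{nℓ}T) ⊗ G_ℓ` are a SLOT of the level data
(as in the tree's `KolyvaginDatum.fs`; Howard's canonical map — evaluation at Frobenius and the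
Artin symbol `k_λˣ/k_ℓˣ ⊃ Gal(L/K_λ)` — is to be pinned by a predicate in part B). -/

section KolyvaginSystems

variable {K : Type} [Field K] [NumberField K] {M : Type} [AddCommGroup M] [TopologicalSpace M]
  [DiscreteTopology M] {R : Type} [CommRing R] [Module R M]

open scoped TensorProduct

/-- **`G_n = ⊗_{ℓ ∣ n} G_ℓ`** over `ℤ` (`G_1 = ℤ`: the empty tensor product).
[cite: Howard2004HeegnerKolyvagin, Def. 1.2.1 (arXiv p. 6, L73–75)] -/
abbrev Gn (n : Finset (HeightOneSpectrum (𝓞 K))) : Type :=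
  PiTensorProduct ℤ fun q : ↥n => Gell (K := K) (q : HeightOneSpectrum (𝓞 K))

/-- `G_1 = ℤ` (the empty tensor product). [cite: Howard2004HeegnerKolyvagin, Def. 1.2.1 (arXiv p. 6, L74–75)] -/
def gnEmptyEquiv : Gn (K := K) ∅ ≃ₗ[ℤ] ℤ :=
  haveI : IsEmpty (↥(∅ : Finset (HeightOneSpectrum (𝓞 K)))) := ⟨fun x => Finset.notMem_empty _ x.2⟩
  PiTensorProduct.isEmptyEquiv _

/-- The index bijection `{q ∈ nℓ} ≃ {q ∈ n} ⊕ pt` for `ℓ ∉ n`. [folklore] -/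
def insertIndexEquiv (v : HeightOneSpectrum (𝓞 K)) (n : Finset (HeightOneSpectrum (𝓞 K)))
    (h : v ∉ n) : ↥(insert v n) ≃ ↥n ⊕ PUnit.{1} :=
  (Finset.subtypeInsertEquivOption h).trans (Equiv.optionEquivSumPUnit _)

/-- **`G_{nℓ} ≅ G_n ⊗ G_ℓ`** for `ℓ ∉ n` (reindexing the finite tensor product).
[cite: Howard2004HeegnerKolyvagin, Def. 1.2.1 (arXiv p. 6, L73–75)] -/
def gnInsertEquiv (v : HeightOneSpectrum (𝓞 K)) (n : Finset (HeightOneSpectrum (𝓞 K)))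
    (h : v ∉ n) : Gn (K := K) (insert v n) ≃ₗ[ℤ] Gn (K := K) n ⊗[ℤ] Gell v :=
  (PiTensorProduct.reindex ℤ (fun q : ↥(insert v n) => Gell (K := K) (q : HeightOneSpectrum (𝓞 K)))
      (insertIndexEquiv v n h)).trans
    ((PiTensorProduct.tmulEquivDep ℤ
        (fun j : ↥n ⊕ PUnit.{1} =>
          Gell (K := K) ((insertIndexEquiv v n h).symm j : HeightOneSpectrum (𝓞 K)))).symm.trans
      (TensorProduct.congr (LinearEquiv.refl ℤ _)
        (PiTensorProduct.subsingletonEquiv (R := ℤ) PUnit.unit)))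

variable (R) in
/-- **Presentations of the Kolyvagin quotients `T/I_nT`, `n ∈ 𝓝(𝓛)`** (objects of `Quot(T)`), with
the slot for the finite–singular comparison maps `φ^{fs}_ℓ` on `T/I_{n}T` at `ℓ`
(`H¹(K_ℓ, T/I_nT) → H¹_s(K_ℓ, T/I_nT) ⊗ G_ℓ`, used on finite classes, for `ℓ ∣ n`).
[cite: Howard2004HeegnerKolyvagin, Def. 1.2.3 and display (ks relations) (arXiv p. 6 L120 – p. 7 L12)] -/
structure LevelData {p : ℕ} (ρ : DiscreteGaloisModule K M) (t : SelmerTriple p ρ)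
    (N : Finset (HeightOneSpectrum (𝓞 K)) → Type) [∀ n, AddCommGroup (N n)]
    [∀ n, TopologicalSpace (N n)] [∀ n, DiscreteTopology (N n)] [∀ n, Module R (N n)] where
  /-- the Galois action on the presentation of `T/I_nT` -/
  ρq : ∀ n, DiscreteGaloisModule K (N n)
  /-- the presenting surjection `T ↠ T/I_nT` -/
  π : ∀ n, M →ₗ[R] N n
  isQuotientBy : ∀ n, IsQuotientBy ρ (levelIdeal (R := R) ρ n) (ρq n) (π n)
  /-- the finite–singular comparison map of `T/I_nT` at `ℓ` (a slot; Howard's is canonical) -/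
  fs : ∀ n (v : HeightOneSpectrum (𝓞 K)),
    galoisCohomology ((ρq n).toLocal (Sum.inr v)) 1 →+
      SingularQuotient (GaloisRep.toLocal v (ρq n)) ⊗[ℤ] Gell v

namespace LevelData

variable {p : ℕ} [Fact p.Prime] {ρ : DiscreteGaloisModule K M} {t : SelmerTriple p ρ}
  {N : Finset (HeightOneSpectrum (𝓞 K)) → Type} [∀ n, AddCommGroup (N n)]
  [∀ n, TopologicalSpace (N n)] [∀ n, DiscreteTopology (N n)] [∀ n, Module R (N n)]

/-- **`H¹_{F(n)}(K, T/I_nT)`**: the Selmer group, on the presentation of `T/I_nT`, of the structure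
`F(n)` (transverse at the primes of `n`, Def. 1.2.2) propagated from `T` (Def. 1.1.3).
[cite: Howard2004HeegnerKolyvagin, Def. 1.2.3 (arXiv p. 7, L1–6)] -/
def selmerAt (D : LevelData R ρ t N) (jbar : AlgebraicClosure K →+* ℂ)
    (n : Finset (HeightOneSpectrum (𝓞 K))) : AddSubgroup (galoisCohomology (D.ρq n) 1) :=
  ((D.isQuotientBy n).propagateStructure (t.atLevel jbar n).cond).selmerGroup

/-- The reduction `T/I_nT → T/I_{nℓ}T` (`I_n ⊆ I_{nℓ}`) on `H¹`. [cite: Howard2004HeegnerKolyvagin, Def. 1.2.3 (arXiv p. 6, L126–140)] -/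
def redH1 (D : LevelData R ρ t N) (n : Finset (HeightOneSpectrum (𝓞 K)))
    (v : HeightOneSpectrum (𝓞 K)) :
    galoisCohomology (D.ρq n) 1 →+ galoisCohomology (D.ρq (insert v n)) 1 :=
  (D.isQuotientBy n).transitionH1 (D.isQuotientBy (insert v n))
    (levelIdeal_mono ρ (Finset.subset_insert v n))

/-- Upper path of (ks relations): `H¹_{F(n)}(K, T/I_nT) ⊗ G_n → H¹(K_ℓ, T/I_{nℓ}T) ⊗ G_n →
(H¹_s(K_ℓ, T/I_{nℓ}T) ⊗ G_ℓ) ⊗ G_n` — reduce, localise at `ℓ`, apply `φ^{fs}_ℓ ⊗ 1`.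
[cite: Howard2004HeegnerKolyvagin, Def. 1.2.3, display (ks relations) (arXiv p. 6, L126–140)] -/
def upperPath (D : LevelData R ρ t N) (jbar : AlgebraicClosure K →+* ℂ)
    (n : Finset (HeightOneSpectrum (𝓞 K))) (v : HeightOneSpectrum (𝓞 K)) :
    ↥(D.selmerAt jbar n) ⊗[ℤ] Gn (K := K) n →ₗ[ℤ]
      (SingularQuotient (GaloisRep.toLocal v (D.ρq (insert v n))) ⊗[ℤ] Gell v) ⊗[ℤ] Gn (K := K) n :=
  TensorProduct.map
    (((D.fs (insert v n) v).comp
        ((galoisCohomology.localization (D.ρq (insert v n)) (Sum.inr v) 1).comp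
          ((D.redH1 n v).comp (D.selmerAt jbar n).subtype))).toIntLinearMap)
    LinearMap.id

/-- Lower path of (ks relations): `H¹_{F(nℓ)}(K, T/I_{nℓ}T) ⊗ G_{nℓ} → H¹_s(K_ℓ, T/I_{nℓ}T) ⊗ G_{nℓ}
≅ (H¹_s(K_ℓ, T/I_{nℓ}T) ⊗ G_ℓ) ⊗ G_n` — localise at `ℓ`, pass to the singular quotient, and
rebracket `G_{nℓ} = G_n ⊗ G_ℓ`.
[cite: Howard2004HeegnerKolyvagin, Def. 1.2.3, display (ks relations) (arXiv p. 6, L126–140)] -/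
def lowerPath (D : LevelData R ρ t N) (jbar : AlgebraicClosure K →+* ℂ)
    (n : Finset (HeightOneSpectrum (𝓞 K))) (v : HeightOneSpectrum (𝓞 K)) (h : v ∉ n) :
    ↥(D.selmerAt jbar (insert v n)) ⊗[ℤ] Gn (K := K) (insert v n) →ₗ[ℤ]
      (SingularQuotient (GaloisRep.toLocal v (D.ρq (insert v n))) ⊗[ℤ] Gell v) ⊗[ℤ]
        Gn (K := K) n :=
  (TensorProduct.assoc ℤ _ _ _).symm.toLinearMap ∘ₗ
    TensorProduct.map
      (((singularMap (GaloisRep.toLocal v (D.ρq (insert v n)))).comp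
          ((galoisCohomology.localization (D.ρq (insert v n)) (Sum.inr v) 1).comp
            (D.selmerAt jbar (insert v n)).subtype)).toIntLinearMap)
      ((TensorProduct.comm ℤ _ _).toLinearMap ∘ₗ (gnInsertEquiv v n h).toLinearMap)

/-- **Kolyvagin systems `KS(T, F, 𝓛)`** (Def. 1.2.3): «a collection of cohomology classes
`κ_n ∈ H¹_{F(n)}(K, T/I_nT) ⊗ G_n`, one for each `n ∈ 𝓝(𝓛)`, such that for any `nℓ ∈ 𝓝(𝓛)` the
images of `κ_n` and `κ_{nℓ}` in `H¹_s(K_ℓ, T/I_{nℓ}T) ⊗ G_{nℓ}` under the maps of (ks relations)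
agree».  A family on ALL finite sets of primes, constrained on the levels `𝓝(𝓛)` only.
[cite: Howard2004HeegnerKolyvagin, Def. 1.2.3 (arXiv Def. 2.2.3, p. 7, L1–12)] -/
def IsKolyvaginSystem (D : LevelData R ρ t N) (jbar : AlgebraicClosure K →+* ℂ)
    (κ : ∀ n : Finset (HeightOneSpectrum (𝓞 K)), ↥(D.selmerAt jbar n) ⊗[ℤ] Gn (K := K) n) : Prop :=
  ∀ (n : Finset (HeightOneSpectrum (𝓞 K))) (v : HeightOneSpectrum (𝓞 K)) (h : v ∉ n),
    insert v n ∈ t.levelSet → D.upperPath jbar n v (κ n) = D.lowerPath jbar n v h (κ (insert v n))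

/-- **The module `KS(T, F, 𝓛)` of Kolyvagin systems** as a subgroup of `Π_n (H¹_{F(n)} ⊗ G_n)`
(families vanishing off `𝓝(𝓛)`, satisfying the relations).
[cite: Howard2004HeegnerKolyvagin, Def. 1.2.3 (arXiv p. 7, L10–12)] -/
def KS (D : LevelData R ρ t N) (jbar : AlgebraicClosure K →+* ℂ) :
    AddSubgroup (∀ n : Finset (HeightOneSpectrum (𝓞 K)), ↥(D.selmerAt jbar n) ⊗[ℤ] Gn (K := K) n)
    where
  carrier := {κ | D.IsKolyvaginSystem jbar κ ∧ ∀ n, n ∉ t.levelSet → κ n = 0}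
  add_mem' := by
    rintro a b ⟨ha, ha'⟩ ⟨hb, hb'⟩
    refine ⟨fun n v h hn => ?_, fun n hn => by simp [ha' n hn, hb' n hn]⟩
    simp only [Pi.add_apply, map_add, ha n v h hn, hb n v h hn]
  zero_mem' := ⟨fun n v h _ => by simp, fun n _ => rfl⟩
  neg_mem' := by
    rintro a ⟨ha, ha'⟩
    refine ⟨fun n v h hn => ?_, fun n hn => by simp [ha' n hn]⟩
    simp only [Pi.neg_apply, map_neg, ha n v h hn]

/-- `κ_1`: the bottom class, in `H¹_F(K, T) ⊗ ℤ` read in `H¹_{F}(K, T/I_1 T)` with `I_1 = 0`.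
[cite: Howard2004HeegnerKolyvagin, Def. 1.2.3 (arXiv p. 7, L1–6)] -/
def kappaOne (D : LevelData R ρ t N) (jbar : AlgebraicClosure K →+* ℂ)
    (κ : ∀ n : Finset (HeightOneSpectrum (𝓞 K)), ↥(D.selmerAt jbar n) ⊗[ℤ] Gn (K := K) n) :
    ↥(D.selmerAt jbar ∅) ⊗[ℤ] Gn (K := K) ∅ :=
  κ ∅

end LevelData

end KolyvaginSystems

/-! ## H. Hypotheses H.0–H.5 (§1.3; arXiv §2.3, p. 7 L29 – p. 8 L8) as `Prop`s

Stated for ONE object `T` of `Mod_{R,K}` carried by the discrete layer (the reading of §1.4–1.5: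
«Let `R` be a principal Artinian coefficient ring of length `k` … assume `(T, F)` and `(T*, F*)`
satisfy H.0–H.5», arXiv p. 8 L5–12); `τ` enters through a `ConjugationDatum` (a complex
conjugation `τ` of `K̄` lifting the non-trivial automorphism of `K`, tree `IsLiftOfAut`, with the
local transports `Γ_{K_v} → Γ_{K_v̄}` it induces at the finite places), `T̄` through a residual
presentation, and H.4's `R(1)` through a PINNED rank-one module (`twistOne_apply`). -/

section Hypotheses

variable {K : Type} [Field K] [NumberField K] {M : Type} [AddCommGroup M] [TopologicalSpace M]
  [DiscreteTopology M] {R : Type} [CommRing R] [Module R M]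

/-- **H.0**: «`T` is a free, rank 2 `R`-module.» [cite: Howard2004HeegnerKolyvagin, H.0 (arXiv p. 7, L57)] -/
def H0 (R : Type) [CommRing R] (M : Type) [AddCommGroup M] [Module R M] : Prop :=
  Module.Free R M ∧ Module.finrank R M = 2

/-- **H.1**: «`T̄ = T/𝔪T` is an absolutely irreducible representation of `(R/𝔪)[[G_K]]`», on a
residual presentation `(T̄, π̄)` (the object of `Quot(T)` for `I = 𝔪`), as BOTH clauses: no proper
non-zero `Γ_K`-stable `R`-submodule, AND every `Γ_K`-equivariant `R`-linear endomorphism of `T̄` is a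
scalar (Schur form; for the finite field `R/𝔪` the conjunction is absolute irreducibility).
[cite: Howard2004HeegnerKolyvagin, H.1 (arXiv p. 7, L59)] -/
def H1 [IsLocalRing R] (ρ : DiscreteGaloisModule K M) {Nbar : Type} [AddCommGroup Nbar]
    [TopologicalSpace Nbar] [DiscreteTopology Nbar] [Module R Nbar] (ρbar : DiscreteGaloisModule K Nbar)
    (πbar : M →ₗ[R] Nbar) : Prop :=
  IsQuotientBy ρ (IsLocalRing.maximalIdeal R) ρbar πbar ∧
    (∀ W : Submodule R Nbar, (∀ (σ : absoluteGaloisGroup K) (x : Nbar), x ∈ W → ρbar σ x ∈ W) →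
      W = ⊥ ∨ W = ⊤) ∧
    Nontrivial Nbar ∧
    ∀ f : Nbar →ₗ[R] Nbar, (∀ (σ : absoluteGaloisGroup K) (x : Nbar), f (ρbar σ x) = ρbar σ (f x)) →
      ∃ c : R, ∀ x, f x = c • x

variable (K) in
/-- **The complex conjugation datum**: `σ` the non-trivial automorphism of `K`, `τ` an INVOLUTION of
`K̄` lifting it (tree `IsLiftOfAut`; an involution of `ℚ̄` is a complex conjugation), and at every
finite place `v` a transport of local Galois groups `φ_v : Γ_{K_v} → Γ_{K_{v̄}}`, `v̄ = v^σ`,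
compatible with conjugation by `τ` up to the inner automorphism of a `δ_v ∈ Γ_K` (the genuine
ambiguity of «conjugation by `τ` induces `H^i(K_v̄, T) ≅ H^i(K_v, Tw(T))`», arXiv p. 7 L44–48;
the tree's adapted lifts `liftAutPlace` furnish such data).
[cite: Howard2004HeegnerKolyvagin, §1.3 (arXiv p. 7, L33–48)] -/
structure ConjugationDatum where
  /-- complex conjugation on `K` -/
  σ : K ≃ₐ[ℚ] K
  σ_ne_one : σ ≠ 1
  /-- a complex conjugation of `K̄` above `σ` -/
  τ : AlgebraicClosure K ≃+* AlgebraicClosure K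
  isLift : EllipticCurves.IsLiftOfAut σ τ
  involutive : Function.Involutive τ
  /-- local transport `Γ_{K_v} → Γ_{K_{v̄}}` -/
  φ : ∀ v : HeightOneSpectrum (𝓞 K),
    absoluteGaloisGroup (v.adicCompletion K) →ₜ* absoluteGaloisGroup ((σ • v).adicCompletion K)
  φ_bijective : ∀ v, Function.Bijective (φ v)
  /-- the inner correction -/
  δ : HeightOneSpectrum (𝓞 K) → absoluteGaloisGroup K
  compat : ∀ v (g : absoluteGaloisGroup (v.adicCompletion K)),
    absGaloisRestrict K ((σ • v).adicCompletion K) (φ v g) =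
      (δ v)⁻¹ * isLift.conjGalCMH (absGaloisRestrict K (v.adicCompletion K) g) * δ v

namespace ConjugationDatum

/-- Conjugation by `τ` on `Γ_K` (`g ↦ τ⁻¹ g τ`; tree `IsLiftOfAut.conjGalCMH`).
[cite: Howard2004HeegnerKolyvagin, §1.3 (arXiv p. 7, L33–41)] -/
abbrev conj (cd : ConjugationDatum K) : absoluteGaloisGroup K →ₜ* absoluteGaloisGroup K :=
  cd.isLift.conjGalCMH

/-- **`Tw(T)`**: «the `G_K`-module whose underlying `R`-module is `T` and on which `G_K` acts through
the automorphism conjugation by `τ`». [cite: Howard2004HeegnerKolyvagin, §1.3 (arXiv p. 7, L33–37)] -/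
def twist (cd : ConjugationDatum K) (ρ : DiscreteGaloisModule K M) : DiscreteGaloisModule K M :=
  ContinuousRep.restrict ρ cd.conj

/-- Unfolding `twist`. [cite: Howard2004HeegnerKolyvagin, §1.3 (arXiv p. 7, L33–37)] -/
@[simp] theorem twist_apply (cd : ConjugationDatum K) (ρ : DiscreteGaloisModule K M)
    (g : absoluteGaloisGroup K) : cd.twist ρ g = ρ (cd.conj g) := rfl

/-- The compatible pair `(φ_v, δ_v)`: `T|_{Γ_{K_v̄}}` pulled back along `φ_v` maps to
`Tw(T)|_{Γ_{K_v}}` by `m ↦ δ_v · m`. [cite: Howard2004HeegnerKolyvagin, §1.3 (arXiv p. 7, L44–48)] -/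
def transportHom (cd : ConjugationDatum K) (ρ : DiscreteGaloisModule K M)
    (v : HeightOneSpectrum (𝓞 K)) :
    TopRep.res (cd.φ v : absoluteGaloisGroup (v.adicCompletion K) →*
        absoluteGaloisGroup ((cd.σ • v).adicCompletion K))
        (DiscreteGaloisModule.toTopRep (ρ.toLocal (Sum.inr (cd.σ • v)))) ⟶
      DiscreteGaloisModule.toTopRep ((cd.twist ρ).toLocal (Sum.inr v)) :=
  TopRep.ofHom
    { toContinuousLinearMap := ⟨ρ (cd.δ v), continuous_of_discreteTopology⟩
      isIntertwining' := fun g => by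
        refine ContinuousLinearMap.ext fun m => ?_
        change ρ.toRepresentation (cd.δ v) (ρ.toRepresentation
            (absGaloisRestrict K ((cd.σ • v).adicCompletion K) (cd.φ v g)) m) =
          ρ.toRepresentation (cd.conj (absGaloisRestrict K (v.adicCompletion K) g))
            (ρ.toRepresentation (cd.δ v) m)
        rw [cd.compat, map_mul, map_mul, Module.End.mul_apply, Module.End.mul_apply,
          ← Module.End.mul_apply (f := ρ.toRepresentation (cd.δ v)), ← map_mul, mul_inv_cancel,
          map_one, Module.End.one_apply] }

/-- **«Conjugation by `τ` induces an isomorphism `H¹(K_v̄, T) ≅ H¹(K_v, Tw(T))`, `v̄ = v^τ`»**, at a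
finite place, along the compatible pair `(φ_v, δ_v)` of the datum.
[cite: Howard2004HeegnerKolyvagin, §1.3 (arXiv p. 7, L44–48)] -/
def transportH1 (cd : ConjugationDatum K) (ρ : DiscreteGaloisModule K M)
    (v : HeightOneSpectrum (𝓞 K)) :
    galoisCohomology (ρ.toLocal (Sum.inr (cd.σ • v))) 1 →+
      galoisCohomology ((cd.twist ρ).toLocal (Sum.inr v)) 1 :=
  (ContinuousCohomology.map (cd.φ v) (cd.transportHom ρ v) 1).hom.toLinearMap.toAddMonoidHom

end ConjugationDatum

/-- **H.2**: «There is a Galois extension `F/ℚ` such that `K ⊂ F`, `G_F` acts trivially on `T`, and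
`H¹(F(μ_{p^∞})/K, T̄) = 0`»: a closed subgroup `Γ_F ≤ Γ_K`, normal and stable under conjugation by
`τ` (so `F/ℚ` is Galois), acting trivially on `T`, such that — `H¹(F(μ_{p^∞})/K, T̄)` being the
kernel of the restriction `H¹(K, T̄) → H¹(F(μ_{p^∞}), T̄)` by inflation–restriction — every class of
`H¹(K, T̄)` restricting to zero on `Γ_{F(μ_{p^∞})} = Γ_F ∩ ⋂_n ker(Γ_K → Aut μ_{p^n})` is zero.
[cite: Howard2004HeegnerKolyvagin, H.2 (arXiv p. 7, L61–63)] -/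
def H2 (p : ℕ) (cd : ConjugationDatum K) (ρ : DiscreteGaloisModule K M) {Nbar : Type}
    [AddCommGroup Nbar] [TopologicalSpace Nbar] [DiscreteTopology Nbar]
    (ρbar : DiscreteGaloisModule K Nbar) : Prop :=
  ∃ ΓF : Subgroup (absoluteGaloisGroup K), ΓF.Normal ∧ IsClosed (ΓF : Set (absoluteGaloisGroup K)) ∧
    (∀ g ∈ ΓF, cd.conj g ∈ ΓF) ∧ (∀ g ∈ ΓF, ∀ m : M, ρ g m = m) ∧
    ∀ c : galoisCohomology ρbar 1,
      (resSubgroup (DiscreteGaloisModule.toTopRep ρbar)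
          (ΓF ⊓ ⨅ n : ℕ, (DiscreteGaloisModule.mu K (p ^ n)).ker) 1).hom c = 0 → c = 0

/-- **H.3**: «For every `v ∈ Σ(F)` the local condition `F` at `v` is cartesian on the category
`Quot(T)`.» [cite: Howard2004HeegnerKolyvagin, H.3 (arXiv p. 7, L65–67)] -/
def H3 {p : ℕ} (ρ : DiscreteGaloisModule K M) (R : Type) [CommRing R] [Module R M]
    (t : SelmerTriple p ρ) : Prop :=
  ∀ v : Place K, v ∈ t.Sigma → IsCartesianOnQuotAt ρ R v (t.cond v)

section H4

variable [TopologicalSpace R] [DiscreteTopology R]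

/-- **The datum of H.4**: «a perfect, symmetric, `R`-bilinear pairing `( , ) : T × T → R(1)` which
satisfies `(s^σ, t^{τστ⁻¹}) = (s, t)^σ`» — `R(1)` being `R` with `Γ_K` acting through the `p`-adic
cyclotomic character (the rank-one module `twistOne`, PINNED by `twistOne_apply`; `R` a
`ℤ_p`-algebra).  «Equivalently there is a `G_K`-invariant pairing `T × Tw(T) → R(1)` which is
symmetric.» [cite: Howard2004HeegnerKolyvagin, H.4 (arXiv p. 7, L69–80)] -/
structure DualityDatum (p : ℕ) [Fact p.Prime] (cd : ConjugationDatum K)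
    (ρ : DiscreteGaloisModule K M) (R : Type) [CommRing R] [TopologicalSpace R]
    [DiscreteTopology R] [Algebra ℤ_[p] R] [Module R M] where
  /-- the pairing `T × T → R(1)` on underlying modules -/
  e : M →ₗ[R] M →ₗ[R] R
  symm : ∀ s t : M, e s t = e t s
  perfect : Function.Bijective e
  equivariant : ∀ (g : absoluteGaloisGroup K) (s t : M),
    e (ρ g s) (ρ (cd.conj g) t) =
      algebraMap ℤ_[p] R ((GaloisRep.cyclotomicCharacter K p g : ℤ_[p]ˣ) : ℤ_[p]) * e s t
  /-- `R(1)` as a discrete `Γ_K`-module -/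
  twistOne : DiscreteGaloisModule K R
  twistOne_apply : ∀ (g : absoluteGaloisGroup K) (r : R),
    twistOne g r = algebraMap ℤ_[p] R ((GaloisRep.cyclotomicCharacter K p g : ℤ_[p]ˣ) : ℤ_[p]) * r

namespace DualityDatum

variable {p : ℕ} [Fact p.Prime] {cd : ConjugationDatum K} {ρ : DiscreteGaloisModule K M}
  [Algebra ℤ_[p] R]

/-- The pairing as a bi-additive map. [cite: Howard2004HeegnerKolyvagin, H.4 (arXiv p. 7, L69–76)] -/
def eHom (D : DualityDatum p cd ρ R) : M →+ M →+ R where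
  toFun s := (D.e s).toAddMonoidHom
  map_zero' := by ext t; simp
  map_add' s s' := by ext t; simp

/-- `Γ_K`-invariance of `T × Tw(T) → R(1)`. [cite: Howard2004HeegnerKolyvagin, H.4 (arXiv p. 7, L74–77)] -/
theorem eHom_equivariant (D : DualityDatum p cd ρ R) (g : absoluteGaloisGroup K) (s t : M) :
    D.eHom (ρ g s) (cd.twist ρ g t) = D.twistOne g (D.eHom s t) := by
  change D.e (ρ g s) (ρ (cd.conj g) t) = D.twistOne g (D.e s t)
  rw [D.equivariant, D.twistOne_apply]

/-- The `Γ_{K_v}`-equivariant pairing `T × Tw(T) → R(1)` of the local modules at a place `v`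
(restriction of `eHom`). [cite: Howard2004HeegnerKolyvagin, H.4 (arXiv p. 7, L74–80)] -/
def ePairingLocal (D : DualityDatum p cd ρ R) (v : Place K) :
    ContPairing (ρ.toLocal v).toTopRep ((cd.twist ρ).toLocal v).toTopRep
      (D.twistOne.toLocal v).toTopRep :=
  DiscreteGaloisModule.pairing (ρ.toLocal v) ((cd.twist ρ).toLocal v) (D.twistOne.toLocal v) D.eHom
    fun _ s t => D.eHom_equivariant _ s t

/-- **The induced local pairing** `H¹(K_v, T) × H¹(K_v, Tw(T)) → H²(K_v, R(1))` at a place `v`: the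
cup product (tree `ContPairing.cupProduct`) of the `Γ_K`-invariant pairing `T × Tw(T) → R(1)`.
Howard composes with the invariant map `inv_v : H²(K_v, R(1)) → R` — injective (an isomorphism at
finite places), so orthogonal complements are the same whether read in `H²` or in `R`.
[cite: Howard2004HeegnerKolyvagin, H.4 (arXiv p. 7, L78–82)] -/
def localCup (D : DualityDatum p cd ρ R) (v : Place K) :
    galoisCohomology (ρ.toLocal v) 1 →+ galoisCohomology ((cd.twist ρ).toLocal v) 1 →+
      galoisCohomology (D.twistOne.toLocal v) 2 where
  toFun x :=
    haveI : CompactSpace (absoluteGaloisGroup (Place.Completion v)) :=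
      absoluteGaloisGroup_compactSpace _
    ((D.ePairingLocal v).cupProduct x).toAddMonoidHom
  map_zero' := by
    haveI : CompactSpace (absoluteGaloisGroup (Place.Completion v)) :=
      absoluteGaloisGroup_compactSpace _
    exact AddMonoidHom.ext fun y => DFunLike.congr_fun (map_zero (D.ePairingLocal v).cupProduct) y
  map_add' x x' := by
    haveI : CompactSpace (absoluteGaloisGroup (Place.Completion v)) :=
      absoluteGaloisGroup_compactSpace _
    exact AddMonoidHom.ext fun y =>
      DFunLike.congr_fun (map_add (D.ePairingLocal v).cupProduct x x') y

/-- **«The local condition `F` is its own exact orthogonal complement under the induced local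
pairing `⟨ , ⟩_v : H¹(K_v, T) × H¹(K_v̄, T) → R`»** at a finite place `v`: with
`F_v̄ ⊂ H¹(K_v̄, T)` transported to `H¹(K_v, Tw(T))`, each of `F_v` and (the transport of) `F_v̄` is
the exact annihilator of the other.  (Archimedean places: `K` is imaginary quadratic in the source,
`Γ_{K_v}` is trivial at the complex place and `H¹(K_v, T) = 0`, where the clause is automatic.)
[cite: Howard2004HeegnerKolyvagin, H.4 (arXiv p. 7, L78–82)] -/
def IsSelfOrthogonalAt (D : DualityDatum p cd ρ R) (𝓕 : SelmerStructure ρ)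
    (v : HeightOneSpectrum (𝓞 K)) : Prop :=
  let Fbar := (𝓕 (Sum.inr (cd.σ • v))).map (cd.transportH1 ρ v)
  (∀ x, x ∈ 𝓕 (Sum.inr v) ↔ ∀ y ∈ Fbar, D.localCup (Sum.inr v) x y = 0) ∧
    ∀ y, y ∈ Fbar ↔ ∀ x ∈ 𝓕 (Sum.inr v), D.localCup (Sum.inr v) x y = 0

/-- **H.4** for `(T, F)` relative to the datum: self-orthogonality at every finite place.
[cite: Howard2004HeegnerKolyvagin, H.4 (arXiv p. 7, L69–82)] -/
def IsSelfOrthogonal (D : DualityDatum p cd ρ R) (𝓕 : SelmerStructure ρ) : Prop :=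
  ∀ v : HeightOneSpectrum (𝓞 K), D.IsSelfOrthogonalAt 𝓕 v

end DualityDatum

end H4

/-- **The datum of H.5(a), first half**: «the action of `G_K` on `T̄` extends to an action of `G_ℚ`» —
`G_ℚ = G_K ⋊ ⟨τ⟩`, so: an `R`-linear involution `θ` of `T̄` (the action of `τ`) with
`θ ∘ ρ̄(τ⁻¹ g τ) = ρ̄(g) ∘ θ`, i.e. an isomorphism `Tw(T̄) ≅ T̄`.
[cite: Howard2004HeegnerKolyvagin, H.5(a) (arXiv p. 7, L93–95)] -/
structure ResidualTau (cd : ConjugationDatum K) {Nbar : Type} [AddCommGroup Nbar]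
    [TopologicalSpace Nbar] [DiscreteTopology Nbar] [Module R Nbar]
    (ρbar : DiscreteGaloisModule K Nbar) where
  /-- the action of `τ` on `T̄` -/
  θ : Nbar →ₗ[R] Nbar
  involutive : ∀ x, θ (θ x) = x
  compat : ∀ (g : absoluteGaloisGroup K) (x : Nbar), θ (ρbar (cd.conj g) x) = ρbar g (θ x)

namespace ResidualTau

variable {cd : ConjugationDatum K} {Nbar : Type} [AddCommGroup Nbar] [TopologicalSpace Nbar]
  [DiscreteTopology Nbar] [Module R Nbar] {ρbar : DiscreteGaloisModule K Nbar}

/-- `θ` on local cohomology: `H¹(K_v, Tw(T̄)) → H¹(K_v, T̄)`. [cite: Howard2004HeegnerKolyvagin, H.5 (arXiv p. 7, L93–97)] -/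
def thetaH1 (A : ResidualTau (R := R) cd ρbar) (v : Place K) :
    galoisCohomology ((cd.twist ρbar).toLocal v) 1 →+ galoisCohomology (ρbar.toLocal v) 1 :=
  ContinuousRep.cohomologyMap ((cd.twist ρbar).toLocal v) (ρbar.toLocal v) A.θ.toAddMonoidHom
    continuous_of_discreteTopology (fun _ x => A.compat _ x) 1

end ResidualTau

/-- **H.5(a), second half**: «the action of `τ` splits `T̄ = T̄⁺ ⊕ T̄⁻` into one-dimensional
eigenspaces» — non-zero `τ`-fixed and `τ`-anti-fixed vectors which together span `T̄` over `R`.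
[cite: Howard2004HeegnerKolyvagin, H.5(a) (arXiv p. 7, L93–95)] -/
def H5a {cd : ConjugationDatum K} {Nbar : Type} [AddCommGroup Nbar] [TopologicalSpace Nbar]
    [DiscreteTopology Nbar] [Module R Nbar] {ρbar : DiscreteGaloisModule K Nbar}
    (A : ResidualTau (R := R) cd ρbar) : Prop :=
  ∃ xp : Nbar, xp ≠ 0 ∧ A.θ xp = xp ∧ ∃ xm : Nbar, xm ≠ 0 ∧ A.θ xm = -xm ∧
    ∀ x : Nbar, ∃ a b : R, x = a • xp + b • xm

/-- **H.5(b)**: «the condition `F` propagated to `T̄` is stable under the action of `G_ℚ`» — at every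
finite place `v`, `τ` carries `F̄_{v̄} ⊂ H¹(K_v̄, T̄)` (transported to `H¹(K_v, Tw T̄)` and pushed by
`θ`) onto `F̄_v`, `F̄` the propagation of `F` to the residual presentation.
[cite: Howard2004HeegnerKolyvagin, H.5(b) (arXiv p. 7, L96–97)] -/
def H5b [IsLocalRing R] {cd : ConjugationDatum K} (ρ : DiscreteGaloisModule K M) {Nbar : Type} [AddCommGroup Nbar]
    [TopologicalSpace Nbar] [DiscreteTopology Nbar] [Module R Nbar]
    {ρbar : DiscreteGaloisModule K Nbar} {πbar : M →ₗ[R] Nbar}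
    (hbar : IsQuotientBy ρ (IsLocalRing.maximalIdeal R) ρbar πbar)
    (A : ResidualTau (R := R) cd ρbar) (𝓕 : SelmerStructure ρ) : Prop :=
  ∀ v : HeightOneSpectrum (𝓞 K),
    ((hbar.propagateStructure 𝓕) (Sum.inr (cd.σ • v))).map
        ((A.thetaH1 (Sum.inr v)).comp (cd.transportH1 ρbar v)) =
      (hbar.propagateStructure 𝓕) (Sum.inr v)

/-- **H.5(c)**: «if H.4 is assumed to hold then the residual pairing `T̄ × T̄ → (R/𝔪)(1)` satisfies
`(s^τ, t^τ) = (s, t)^τ`» — `τ` acting on `(R/𝔪)(1)` by the cyclotomic character `χ(τ) = -1`; stated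
on lifts to `T` (the residual pairing `(π̄ s, π̄ t) ↦ (s,t) mod 𝔪` is well defined).
[cite: Howard2004HeegnerKolyvagin, H.5(c) (arXiv p. 7 L98 – p. 8 L1)] -/
def H5c [IsLocalRing R] {p : ℕ} [Fact p.Prime] [TopologicalSpace R] [DiscreteTopology R]
    [Algebra ℤ_[p] R]
    {cd : ConjugationDatum K} {ρ : DiscreteGaloisModule K M} (D : DualityDatum p cd ρ R)
    {Nbar : Type} [AddCommGroup Nbar] [TopologicalSpace Nbar] [DiscreteTopology Nbar]
    [Module R Nbar] {ρbar : DiscreteGaloisModule K Nbar} (πbar : M →ₗ[R] Nbar)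
    (A : ResidualTau (R := R) cd ρbar) : Prop :=
  ∀ s t s' t' : M, πbar s' = A.θ (πbar s) → πbar t' = A.θ (πbar t) →
    Ideal.Quotient.mk (IsLocalRing.maximalIdeal R) (D.e s' t') =
      - Ideal.Quotient.mk (IsLocalRing.maximalIdeal R) (D.e s t)

/-- **`(T, F, 𝓛)` satisfies Hypotheses H.0–H.5** (relative to the conjugation datum, a residual
presentation `(T̄, π̄)`, the `G_ℚ`-structure `θ` on `T̄` and the duality datum of H.4).  Howard
imposes H.0–H.5 on `(T, F)` AND on `(T*, F*)`, `T* = Hom(T, R(1))` with the dual structure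
(arXiv p. 8, L11–12); the dual triple is a second instance of this predicate.
[cite: Howard2004HeegnerKolyvagin, §1.3, H.0–H.5 (arXiv p. 7 L55 – p. 8 L1)] -/
structure SatisfiesH [IsLocalRing R] {p : ℕ} [Fact p.Prime] [TopologicalSpace R] [DiscreteTopology R]
    [Algebra ℤ_[p] R] (cd : ConjugationDatum K) {ρ : DiscreteGaloisModule K M}
    (t : SelmerTriple p ρ) {Nbar : Type} [AddCommGroup Nbar] [TopologicalSpace Nbar]
    [DiscreteTopology Nbar] [Module R Nbar] (ρbar : DiscreteGaloisModule K Nbar)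
    (πbar : M →ₗ[R] Nbar) (A : ResidualTau (R := R) cd ρbar) (D : DualityDatum p cd ρ R) :
    Prop where
  isScalarLinear : ρ.IsScalarLinear R
  h0 : H0 R M
  h1 : H1 (R := R) ρ ρbar πbar
  h2 : H2 p cd ρ ρbar
  h3 : H3 ρ R t
  h4 : D.IsSelfOrthogonal t.cond
  h5a : H5a (R := R) A
  h5b : H5b (R := R) ρ h1.1 A t.cond
  h5c : H5c D πbar A

end Hypotheses

end Literature.NumberTheory.GaloisCohomology.Howard2004
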